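import Summits.BirchSwinnertonDyer.BirchSwinnertonDyer.Theorems.PrintCf2RamifiedOffTYZGenusPeriodSecondNorm
import Literature.NumberTheory.EllipticCurves.BSDAnalyticRankTunnellCMProofs
import HarnessLib

/-!
# THE RE-CUT OF C⁺ ON THE VISIBLE R2 ROWS: «THEOREM A» + «SECOND NORM NON-SQUARE» ⟹ C⁺ there, BY NAME; and the full text of C⁺ from
# (display, THEOREM A, second-norm law, off-visible-R2 remainder) — the kernel composition of skeleton v10 of crux stmt-BirchSwinnertonDyer-20509
# (`RamifiedOffTYZOfFacts`, line `offtyz-v7`, LEAD cruxlead-20509 g30, cycle 31, part B4)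

HONEST FRAMING (cell `bsd-print-cf2`, route `PrintCf2`; `--supports stmt-BirchSwinnertonDyer-20509`; theorems only, `def`-free, no `sorry`, no named
fact introduced).  BSD is not proved by any of this; no class is closed by this file; item 23431 (C⁺) and crux 20509 stay OPEN.  The hypotheses named
«THEOREM A» (`hA`) and «SECOND-NORM LAW» (`hS`) and «REMAINDER» (`hO`) below are STATEMENTS TAKEN AS HYPOTHESES (spelled inline, no `def`), exactly as
a registered stub is consumed by a skeleton composition; nothing asserts them.  Director (711)(C) asked for the CM-side law of the R2 sector to be typed as a
stub of the LEAD's own line; after g29's (A1)–(A3) and parts B1–B3 of this cycle the exact-descent currency is the sharp form of that request: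

* «THEOREM A on R2» (g29 memo `Lines/offtyz_v7_ExactDescent.md` §2; a theorem ON PAPER from the η-quotient character of `√x = η₁₆³/(η₈η₃₂²)` and
  Shimura reciprocity at level-32 Heegner points; 37/37 numerically): for primes `l ≡ 1`, `q ≡ 7 (mod 8)` with `(l/q) = 1`, every display package of
  `n = lq` and every realisation of the seven-block display at `n`, the first norm `N₁ = N_{H/L} x(z_n)` is a square in `ℍ′_n`.
* «SECOND-NORM LAW on the visible R2 class rows» (conjecture-grade; by `GenusPeriodSecondNorm.levelTwo_iff_secondNorm_of_visible_R2` it is EQUIVALENT to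
  C⁺ there granted Theorem A — §3 below proves the converse direction): on a class row (`ord L(E_{lq}) = 1`, `#Sel₂ = 2⁵`, `#Sel₄ = 2⁶`) with a
  visible generator, for every package / realisation / norms `N₁, N₀` with `[N₁] = 1`: `N₀ ∉ ℍ′² ∧ N₀·i ∉ ℍ′²`.
* «REMAINDER»: C⁺'s text on the class rows that are NOT visible R2 rows (invisible R2 rows, `n ≡ 5, 6 (mod 8)`, three or more primes, …), granted 𝔅_ram.

Results: §1 ★★★ `levelTwo_of_laws_visR2` (conjuncts 1, 2, 4, 5 + `tyz_sevenBlockCMData` + Theorem A + the second-norm law at the row ⟹ `2 ∥ L` for every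
`L` with `𝓛(lq)² = L²`); §2 ★★★★ `levelTwoScriptLExact_of_laws` (𝔅_ram VERBATIM + `tyz_sevenBlockCMData` + Theorem A + (𝔅 → second-norm law) +
(𝔅 → remainder) ⟹ the text of C⁺ = `RamifiedJumpOneLevelTwoOfFacts` VERBATIM — the sorry-free derivation used by skeleton v10); §3 ★★
`secondNormLaw_of_levelTwoScriptLExact` (conjuncts 1, 2, 4, 5 + C⁺ ⟹ the second-norm law: the new stub is not stronger than what it replaces, granted
Theorem A's guard `[N₁] = 1`).

References: [cite: TianYuanZhang2017, §1, §3.1 (p0011 L27–L73), §3.2, Thm. 3.5, Lemma 3.18, Thm. 1.2]; [cite: BurungaleFlach2024, Thm 1.1 / Cor. 3]; [cite: Darmon2004, Thm. 3.22];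
[cite: SilvermanAEC2009, Thm. X.1.1, Prop. X.1.4]; [cite: NeukirchSchmidtWingberg2008, §1.5]; tree: p799839, p800776, p801252, p802109, p802477, p802722.
-/

noncomputable section

open scoped Classical

open WeierstrassCurve WeierstrassCurve.Affine WeierstrassCurve.Affine.Point
  Literature.NumberTheory.EllipticCurves Literature.NumberTheory.EllipticCurves.Rank1Residual
  Summit.BirchSwinnertonDyer.Rank1Residual
  Literature.NumberTheory.EllipticCurves.TianYuanZhang2017
  Literature.NumberTheory.EllipticCurves.TianYuanZhang2017.W2
  Summit.BirchSwinnertonDyer.PrintCf2.VisibleGenerator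

set_option autoImplicit false

namespace Summit.BirchSwinnertonDyer.PrintCf2.SecondNormLaws

variable {n : ℕ}

open Literature.NumberTheory.EllipticCurves.TianYuanZhang2017.GenusPointData (galPtOver)

/-! ## §1 Visible R2 rows: THEOREM A + the second-norm law ⟹ C⁺ at `lq` -/

/-- ★★★ **THEOREM A + SECOND-NORM LAW ⟹ C⁺ AT A VISIBLE R2 CLASS ROW.**  Conjuncts 1, 2, 4, 5 of 𝔅_ram + `tyz_sevenBlockCMData`; primes `l ≡ 1`,
`q ≡ 7 (mod 8)`, `n = lq`, `ord_{s=1} L(E_n, s) = 1` (no `(l/q)`, no Selmer hypothesis needed here); a visible generator `h = (X, Y)` of `A_n(ℚ)`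
modulo torsion; «THEOREM A» for this `(l, q, n)` (`hA`, inline) and the «SECOND-NORM LAW» for this row (`hS`, inline).  Then `2 ∥ L` for every `L` with
`𝓛(n)² = L²`.  Proof: the seven-block display of the package gives the CM point and `Φ`; `Z(n)` is not torsion (p802477), so the exact-descent identities hold
for the norms `N₁, N₀` (p800776); `hA` gives `[N₁] = 1`, `hS` gives `N₀ ∉ ⟨i⟩ℍ′²`, and `GenusPeriodSecondNorm.levelTwo_iff_secondNorm_of_visible_R2` (p802722)
concludes. [cite: TianYuanZhang2017, §1, §3.1, §3.2, Thm. 3.5, Lemma 3.18, Thm. 1.2] [cite: BurungaleFlach2024, Thm 1.1 / Cor. 3] [cite: Darmon2004, Thm. 3.22]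
[cite: SilvermanAEC2009, Thm. X.1.1, Prop. X.1.4] [cite: NeukirchSchmidtWingberg2008, §1.5] -/
theorem levelTwo_of_laws_visR2 (hGZK : rank_eq_analyticRank_of_analyticRank_le_one)
    (hmod : WeierstrassCurve.hasEntireLFunction_rat) (hCM0 : bsdTriple_of_hasCM_of_L_one_ne_zero) (h12 : thm12_parity_of_scriptL')
    (hT : tyz_sevenBlockCMData)
    {l q : ℕ} (hl : l.Prime) (hq : q.Prime) (hl8 : l % 8 = 1) (hq8 : q % 8 = 7) (hn : n = l * q)
    (hr : (congruentNumberCurve n).analyticRank = 1)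
    {X Y : ℚ} (h : (Atwo n).toAffine.Nonsingular X Y) (hX : ¬ ∃ s : ℚ, X = 2 * s ^ 2)
    (hgen : ∀ P : (Atwo n).toAffine.Point, ∃ m : ℤ, IsOfFinAddOrder (P - m • (Point.some X Y h : (Atwo n).toAffine.Point)))
    (hA : ∀ (D : GenusPointData n), D.Printed → D.CMPointCompositumPrinted → D.Thm35AtBlocks →
      ∀ (M : Type) (_ : Field M) (_ : NumberField M) (_ : IsGalois ℚ M) (ι : D.H →ₐ[ℚ] M) (x₀ y₀ : M)
        (h₀ : (curveA.baseChange M).toAffine.Nonsingular x₀ y₀) (Φ : Finset (M ≃ₐ[ℚ] M)),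
        (Point.map (W' := curveA) ι (D.Z n) = ∑ t ∈ Φ, galPtOver M t (.some x₀ y₀ h₀) ∧ Φ.card = gK n) →
        (∀ t ∈ Φ, ¬ ((2 : ℕ) • galPtOver M t (.some x₀ y₀ h₀) = 0 ∨ (2 : ℕ) • galPtOver M t (.some x₀ y₀ h₀) = tauOne)) →
        (∀ g : M ≃ₐ[ℚ] M, D.TrivialOnLOver ι n g →
          ∃ π : Φ → Φ, Function.Bijective π ∧
            ∀ t : Φ, galPtOver M g (galPtOver M (t : M ≃ₐ[ℚ] M) (.some x₀ y₀ h₀)) = galPtOver M (π t : M ≃ₐ[ℚ] M) (.some x₀ y₀ h₀)) →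
        ∀ N₁ : D.H, ι N₁ = ∏ t ∈ Φ, (t : M ≃ₐ[ℚ] M) x₀ → ∃ r : D.H, N₁ = r ^ 2)
    (hS : ∀ (D : GenusPointData n), D.Printed → D.CMPointCompositumPrinted → D.Thm35AtBlocks →
      ∀ (M : Type) (_ : Field M) (_ : NumberField M) (_ : IsGalois ℚ M) (ι : D.H →ₐ[ℚ] M) (x₀ y₀ : M)
        (h₀ : (curveA.baseChange M).toAffine.Nonsingular x₀ y₀) (Φ : Finset (M ≃ₐ[ℚ] M)),
        (Point.map (W' := curveA) ι (D.Z n) = ∑ t ∈ Φ, galPtOver M t (.some x₀ y₀ h₀) ∧ Φ.card = gK n) →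
        (∀ t ∈ Φ, ¬ ((2 : ℕ) • galPtOver M t (.some x₀ y₀ h₀) = 0 ∨ (2 : ℕ) • galPtOver M t (.some x₀ y₀ h₀) = tauOne)) →
        (∀ g : M ≃ₐ[ℚ] M, D.TrivialOnLOver ι n g →
          ∃ π : Φ → Φ, Function.Bijective π ∧
            ∀ t : Φ, galPtOver M g (galPtOver M (t : M ≃ₐ[ℚ] M) (.some x₀ y₀ h₀)) = galPtOver M (π t : M ≃ₐ[ℚ] M) (.some x₀ y₀ h₀)) →
        ∀ N₁ N₀ : D.H, ι N₁ = ∏ t ∈ Φ, (t : M ≃ₐ[ℚ] M) x₀ → ι N₀ = ∏ t ∈ Φ, ((t : M ≃ₐ[ℚ] M) x₀ - 2 * ι D.im) →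
          sqClass N₁ = 1 → ¬ ((∃ s : D.H, N₀ = s ^ 2) ∨ ∃ s : D.H, N₀ * D.im = s ^ 2)) :
    ∀ L : ℤ, IsScriptL n L → (2 : ℤ) ∣ L ∧ ¬ (4 : ℤ) ∣ L := by
  have hmod8 : n % 8 = 7 := by rw [hn, Nat.mul_mod, hl8, hq8]
  obtain ⟨hsq, -, -⟩ := GenusPeriodNonTorsion.squarefree_and_mod_two_primes hl hq hl8 (Or.inr hq8) hn
  have hnd : n ∈ n.divisors := Nat.mem_divisors_self n hsq.ne_zero
  obtain ⟨D, hPr, hC, hBl, hSeven⟩ := hT n hsq (Or.inr (Or.inr hmod8))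
  have hZ : ¬ IsOfFinAddOrder (D.Z n) :=
    GenusPeriodNonTorsion.genusPeriod_not_isOfFinAddOrder_two_primes hGZK h12 hl hq hl8 (Or.inr hq8) hn hr D hPr hBl
  have hZ2 : (2 : ℕ) • D.Z n ≠ 0 := fun h2 => hZ (isOfFinAddOrder_iff_nsmul_eq_zero.mpr ⟨2, two_pos, h2⟩)
  obtain ⟨M, iF, iN, iG, ι, z, Φ, ⟨hS1, hcard⟩, hS2, hS3⟩ := hSeven n hnd hmod8
  have hΦ : Φ.Nonempty := Finset.card_pos.mp (by rw [hcard]; exact GenusPeriodNorm.gK_pos n)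
  obtain ⟨t₀, ht₀⟩ := hΦ
  have hz : z ≠ 0 := by
    intro hz
    apply GenusPointData.galPtOver_ne_zero_of_not_cusp hS2 ht₀
    rw [hz, _root_.map_zero]
  rcases z with _ | ⟨x₀, y₀, h₀⟩
  · exact absurd rfl hz
  obtain ⟨N₁, hN₁, hne₁, hκ₁⟩ := GenusPeriodTraceNorm.twoDescentComponent_genusPeriod_eq_sqClass_norm_zero D ι h₀ Φ hS1 hS2 hS3 hZ2
  obtain ⟨N₀, hN₀, hne₀, hκ₀⟩ := GenusPeriodTraceNorm.twoDescentComponent_genusPeriod_eq_sqClass_norm D ι h₀ Φ hS1 hS2 hS3 hZ2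
  have hA1 : sqClass N₁ = 1 := by
    obtain ⟨r, hr1⟩ := hA D hPr hC hBl M iF iN iG ι x₀ y₀ h₀ Φ ⟨hS1, hcard⟩ hS2 hS3 N₁ hN₁
    exact (sqClass_eq_one_iff hne₁).mpr ⟨r, hr1⟩
  have hN0 := hS D hPr hC hBl M iF iN iG ι x₀ y₀ h₀ Φ ⟨hS1, hcard⟩ hS2 hS3 N₁ N₀ hN₁ hN₀ hA1
  exact (GenusPeriodSecondNorm.levelTwo_iff_secondNorm_of_visible_R2 hGZK hmod hCM0 h12 hl hq hl8 hq8 hn hr D hPr hC hBl h hX hgen hne₀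
    hκ₁ hκ₀ hA1).mpr hN0

/-! ## §2 The whole text of C⁺ from the four pieces (the composition of skeleton v10) -/

/-- ★★★★ **C⁺ = `RamifiedJumpOneLevelTwoOfFacts` VERBATIM from: 𝔅_ram, the display fact `tyz_sevenBlockCMData`, «THEOREM A on R2» (`hA`), «𝔅_ram →
SECOND-NORM LAW on the visible R2 class rows» (`hS`) and «𝔅_ram → C⁺ off the visible R2 rows» (`hO`).**  The case split «visible R2 row or not» is decidable
bookkeeping; on a visible R2 row §1 applies with conjuncts 1, 2, 4, 5 of 𝔅_ram.  This is the sorry-free term by which skeleton v10 DERIVES the stub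
`stub_offTYZ_levelTwoScriptLExact` from its four new stubs. [cite: TianYuanZhang2017, §1, §3.1, §3.2, Thm. 3.5, Lemma 3.18, Thm. 1.2]
[cite: BurungaleFlach2024, Thm 1.1 / Cor. 3] [cite: Darmon2004, Thm. 3.22] [cite: SilvermanAEC2009, Thm. X.1.1, Prop. X.1.4] [cite: NeukirchSchmidtWingberg2008, §1.5] -/
theorem levelTwoScriptLExact_of_laws
    (hB : (Literature.NumberTheory.EllipticCurves.rank_eq_analyticRank_of_analyticRank_le_one ∧ WeierstrassCurve.hasEntireLFunction_rat ∧ WeierstrassCurve.bsdRHS_eq_of_isIsogenous ∧ Literature.NumberTheory.EllipticCurves.bsdTriple_of_hasCM_of_L_one_ne_zero ∧ Literature.NumberTheory.EllipticCurves.TianYuanZhang2017.thm12_parity_of_scriptL' ∧ Literature.NumberTheory.EllipticCurves.Tian2014.thm13_rank_one_and_sha_odd ∧ Literature.NumberTheory.QuadraticFields.RedeiReichardt.redeiReichardt_fourTwoCard_classGroup ∧ Literature.NumberTheory.EllipticCurves.LiLiuTian2024.thm12_bsd_congruentNumberCurve ∧ Literature.NumberTheory.EllipticCurves.Monsky1990.cor515_rank_eq_one_and_card_selmerGroup_two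 ∧ Literature.NumberTheory.EllipticCurves.HeathBrown1994.monsky_card_selmerGroup_two_even ∧ Literature.NumberTheory.EllipticCurves.Tian2014.tian2014_system_sMinus_genus))
    (hT : tyz_sevenBlockCMData)
    (hA : ∀ (l q n : ℕ), l.Prime → q.Prime → l % 8 = 1 → q % 8 = 7 → IsSquare ((l : ℤ) : ZMod q) → n = l * q →
      ∀ (D : GenusPointData n), D.Printed → D.CMPointCompositumPrinted → D.Thm35AtBlocks →
      ∀ (M : Type) (_ : Field M) (_ : NumberField M) (_ : IsGalois ℚ M) (ι : D.H →ₐ[ℚ] M) (x₀ y₀ : M)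
        (h₀ : (curveA.baseChange M).toAffine.Nonsingular x₀ y₀) (Φ : Finset (M ≃ₐ[ℚ] M)),
        (Point.map (W' := curveA) ι (D.Z n) = ∑ t ∈ Φ, galPtOver M t (.some x₀ y₀ h₀) ∧ Φ.card = gK n) →
        (∀ t ∈ Φ, ¬ ((2 : ℕ) • galPtOver M t (.some x₀ y₀ h₀) = 0 ∨ (2 : ℕ) • galPtOver M t (.some x₀ y₀ h₀) = tauOne)) →
        (∀ g : M ≃ₐ[ℚ] M, D.TrivialOnLOver ι n g →
          ∃ π : Φ → Φ, Function.Bijective π ∧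
            ∀ t : Φ, galPtOver M g (galPtOver M (t : M ≃ₐ[ℚ] M) (.some x₀ y₀ h₀)) = galPtOver M (π t : M ≃ₐ[ℚ] M) (.some x₀ y₀ h₀)) →
        ∀ N₁ : D.H, ι N₁ = ∏ t ∈ Φ, (t : M ≃ₐ[ℚ] M) x₀ → ∃ r : D.H, N₁ = r ^ 2)
    (hS : (Literature.NumberTheory.EllipticCurves.rank_eq_analyticRank_of_analyticRank_le_one ∧ WeierstrassCurve.hasEntireLFunction_rat ∧ WeierstrassCurve.bsdRHS_eq_of_isIsogenous ∧ Literature.NumberTheory.EllipticCurves.bsdTriple_of_hasCM_of_L_one_ne_zero ∧ Literature.NumberTheory.EllipticCurves.TianYuanZhang2017.thm12_parity_of_scriptL' ∧ Literature.NumberTheory.EllipticCurves.Tian2014.thm13_rank_one_and_sha_odd ∧ Literature.NumberTheory.QuadraticFields.RedeiReichardt.redeiReichardt_fourTwoCard_classGroup ∧ Literature.NumberTheory.EllipticCurves.LiLiuTian2024.thm12_bsd_congruentNumberCurve ∧ Literature.NumberTheory.EllipticCurves.Monsky1990.cor515_rank_eq_one_and_card_selmerGroup_two ∧ Literature.NumberTheory.EllipticCurves.HeathBrown1994.monsky_card_selmerGroup_two_even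 ∧ Literature.NumberTheory.EllipticCurves.Tian2014.tian2014_system_sMinus_genus) →
      ∀ (l q n : ℕ), l.Prime → q.Prime → l % 8 = 1 → q % 8 = 7 → IsSquare ((l : ℤ) : ZMod q) → n = l * q →
      (congruentNumberCurve n).analyticRank = 1 →
      Nat.card ((congruentNumberCurve n).selmerGroup 2) = 2 ^ 5 → Nat.card ((congruentNumberCurve n).selmerGroup 4) = 2 ^ 6 →
      (∃ (X Y : ℚ) (h : (Atwo n).toAffine.Nonsingular X Y),
        (∀ P : (Atwo n).toAffine.Point, ∃ m : ℤ, IsOfFinAddOrder (P - m • (Point.some X Y h : (Atwo n).toAffine.Point))) ∧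
          ¬ ∃ s : ℚ, X = 2 * s ^ 2) →
      ∀ (D : GenusPointData n), D.Printed → D.CMPointCompositumPrinted → D.Thm35AtBlocks →
      ∀ (M : Type) (_ : Field M) (_ : NumberField M) (_ : IsGalois ℚ M) (ι : D.H →ₐ[ℚ] M) (x₀ y₀ : M)
        (h₀ : (curveA.baseChange M).toAffine.Nonsingular x₀ y₀) (Φ : Finset (M ≃ₐ[ℚ] M)),
        (Point.map (W' := curveA) ι (D.Z n) = ∑ t ∈ Φ, galPtOver M t (.some x₀ y₀ h₀) ∧ Φ.card = gK n) →
        (∀ t ∈ Φ, ¬ ((2 : ℕ) • galPtOver M t (.some x₀ y₀ h₀) = 0 ∨ (2 : ℕ) • galPtOver M t (.some x₀ y₀ h₀) = tauOne)) →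
        (∀ g : M ≃ₐ[ℚ] M, D.TrivialOnLOver ι n g →
          ∃ π : Φ → Φ, Function.Bijective π ∧
            ∀ t : Φ, galPtOver M g (galPtOver M (t : M ≃ₐ[ℚ] M) (.some x₀ y₀ h₀)) = galPtOver M (π t : M ≃ₐ[ℚ] M) (.some x₀ y₀ h₀)) →
        ∀ N₁ N₀ : D.H, ι N₁ = ∏ t ∈ Φ, (t : M ≃ₐ[ℚ] M) x₀ → ι N₀ = ∏ t ∈ Φ, ((t : M ≃ₐ[ℚ] M) x₀ - 2 * ι D.im) →
          sqClass N₁ = 1 → ¬ ((∃ s : D.H, N₀ = s ^ 2) ∨ ∃ s : D.H, N₀ * D.im = s ^ 2))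
    (hO : (Literature.NumberTheory.EllipticCurves.rank_eq_analyticRank_of_analyticRank_le_one ∧ WeierstrassCurve.hasEntireLFunction_rat ∧ WeierstrassCurve.bsdRHS_eq_of_isIsogenous ∧ Literature.NumberTheory.EllipticCurves.bsdTriple_of_hasCM_of_L_one_ne_zero ∧ Literature.NumberTheory.EllipticCurves.TianYuanZhang2017.thm12_parity_of_scriptL' ∧ Literature.NumberTheory.EllipticCurves.Tian2014.thm13_rank_one_and_sha_odd ∧ Literature.NumberTheory.QuadraticFields.RedeiReichardt.redeiReichardt_fourTwoCard_classGroup ∧ Literature.NumberTheory.EllipticCurves.LiLiuTian2024.thm12_bsd_congruentNumberCurve ∧ Literature.NumberTheory.EllipticCurves.Monsky1990.cor515_rank_eq_one_and_card_selmerGroup_two ∧ Literature.NumberTheory.EllipticCurves.HeathBrown1994.monsky_card_selmerGroup_two_even ∧ Literature.NumberTheory.EllipticCurves.Tian2014.tian2014_system_sMinus_genus) →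
      ∀ (n : ℕ) [(congruentNumberCurve n).IsElliptic] [(congruentNumberCurve n).IsGloballyMinimal],
      Squarefree n → (n % 8 = 5 ∨ n % 8 = 6 ∨ n % 8 = 7) →
      (congruentNumberCurve n).analyticRank = 1 →
      Nat.card ((congruentNumberCurve n).selmerGroup 2) = 2 ^ 5 →
      Nat.card ((congruentNumberCurve n).selmerGroup 4) = 2 ^ 6 →
      ¬ ((∃ l q : ℕ, l.Prime ∧ q.Prime ∧ l % 8 = 1 ∧ q % 8 = 7 ∧ IsSquare ((l : ℤ) : ZMod q) ∧ n = l * q) ∧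
          ∃ (X Y : ℚ) (h : (Atwo n).toAffine.Nonsingular X Y),
            (∀ P : (Atwo n).toAffine.Point, ∃ m : ℤ, IsOfFinAddOrder (P - m • (Point.some X Y h : (Atwo n).toAffine.Point))) ∧
              ¬ ∃ s : ℚ, X = 2 * s ^ 2) →
      ∀ L : ℤ, IsScriptL n L → (2 : ℤ) ∣ L ∧ ¬ (4 : ℤ) ∣ L) :
    ∀ (n : ℕ) [(congruentNumberCurve n).IsElliptic] [(congruentNumberCurve n).IsGloballyMinimal],
      Squarefree n → (n % 8 = 5 ∨ n % 8 = 6 ∨ n % 8 = 7) →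
      (congruentNumberCurve n).analyticRank = 1 →
      Nat.card ((congruentNumberCurve n).selmerGroup 2) = 2 ^ 5 →
      Nat.card ((congruentNumberCurve n).selmerGroup 4) = 2 ^ 6 →
      ∀ L : ℤ, IsScriptL n L → (2 : ℤ) ∣ L ∧ ¬ (4 : ℤ) ∣ L := by
  intro n _ _ hsq h8 hr hSel2 hSel4
  by_cases hvis : (∃ l q : ℕ, l.Prime ∧ q.Prime ∧ l % 8 = 1 ∧ q % 8 = 7 ∧ IsSquare ((l : ℤ) : ZMod q) ∧ n = l * q) ∧
      ∃ (X Y : ℚ) (h : (Atwo n).toAffine.Nonsingular X Y),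
        (∀ P : (Atwo n).toAffine.Point, ∃ m : ℤ, IsOfFinAddOrder (P - m • (Point.some X Y h : (Atwo n).toAffine.Point))) ∧
          ¬ ∃ s : ℚ, X = 2 * s ^ 2
  · obtain ⟨⟨l, q, hl, hq, hl8, hq8, hlq, hn⟩, X, Y, h, hgen, hX⟩ := hvis
    exact levelTwo_of_laws_visR2 hB.1 hB.2.1 hB.2.2.2.1 hB.2.2.2.2.1 hT hl hq hl8 hq8 hn hr h hX hgen
      (hA l q n hl hq hl8 hq8 hlq hn) (hS hB l q n hl hq hl8 hq8 hlq hn hr hSel2 hSel4 ⟨X, Y, h, hgen, hX⟩)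
  · exact hO hB n hsq h8 hr hSel2 hSel4 hvis

/-! ## §3 Honesty: the second-norm law FOLLOWS from C⁺ (granted conjuncts 1, 2, 4, 5) -/

/-- ★★ **C⁺ ⟹ THE SECOND-NORM LAW** (conjuncts 1, 2, 4, 5 of 𝔅_ram; no display fact needed — the law quantifies over packages).  So, granted THEOREM A's
guard `[N₁] = 1`, the new stub `stub_offTYZ_secondNormNonsquare_visR2` of skeleton v10 is EXACTLY the visible-R2 content of C⁺, neither more nor less.
Proof: the realisation's norms coincide with the ones of p800776 (`ι` is injective), whose exact-descent identities hold because `Z(n)` is not torsion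
(p802477); then `GenusPeriodSecondNorm.levelTwo_iff_secondNorm_of_visible_R2` (p802722) read left to right. [cite: TianYuanZhang2017, §1, §3.1, §3.2, Thm. 3.5, Lemma 3.18, Thm. 1.2]
[cite: BurungaleFlach2024, Thm 1.1 / Cor. 3] [cite: Darmon2004, Thm. 3.22] [cite: SilvermanAEC2009, Thm. X.1.1, Prop. X.1.4] [cite: NeukirchSchmidtWingberg2008, §1.5] -/
theorem secondNormLaw_of_levelTwoScriptLExact (hGZK : rank_eq_analyticRank_of_analyticRank_le_one)
    (hmod : WeierstrassCurve.hasEntireLFunction_rat) (hCM0 : bsdTriple_of_hasCM_of_L_one_ne_zero) (h12 : thm12_parity_of_scriptL')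
    (hC : ∀ (n : ℕ) [(congruentNumberCurve n).IsElliptic] [(congruentNumberCurve n).IsGloballyMinimal],
      Squarefree n → (n % 8 = 5 ∨ n % 8 = 6 ∨ n % 8 = 7) →
      (congruentNumberCurve n).analyticRank = 1 →
      Nat.card ((congruentNumberCurve n).selmerGroup 2) = 2 ^ 5 →
      Nat.card ((congruentNumberCurve n).selmerGroup 4) = 2 ^ 6 →
      ∀ L : ℤ, IsScriptL n L → (2 : ℤ) ∣ L ∧ ¬ (4 : ℤ) ∣ L)
    {l q : ℕ} (hl : l.Prime) (hq : q.Prime) (hl8 : l % 8 = 1) (hq8 : q % 8 = 7) (hn : n = l * q)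
    (hr : (congruentNumberCurve n).analyticRank = 1)
    (hSel2 : Nat.card ((congruentNumberCurve n).selmerGroup 2) = 2 ^ 5) (hSel4 : Nat.card ((congruentNumberCurve n).selmerGroup 4) = 2 ^ 6)
    (hvis : ∃ (X Y : ℚ) (h : (Atwo n).toAffine.Nonsingular X Y),
      (∀ P : (Atwo n).toAffine.Point, ∃ m : ℤ, IsOfFinAddOrder (P - m • (Point.some X Y h : (Atwo n).toAffine.Point))) ∧ ¬ ∃ s : ℚ, X = 2 * s ^ 2)
    (D : GenusPointData n) (hPr : D.Printed) (hCo : D.CMPointCompositumPrinted) (hBl : D.Thm35AtBlocks)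
    (M : Type) [Field M] [NumberField M] [IsGalois ℚ M] (ι : D.H →ₐ[ℚ] M) (x₀ y₀ : M)
    (h₀ : (curveA.baseChange M).toAffine.Nonsingular x₀ y₀) (Φ : Finset (M ≃ₐ[ℚ] M))
    (hS1 : Point.map (W' := curveA) ι (D.Z n) = ∑ t ∈ Φ, galPtOver M t (.some x₀ y₀ h₀) ∧ Φ.card = gK n)
    (hS2 : ∀ t ∈ Φ, ¬ ((2 : ℕ) • galPtOver M t (.some x₀ y₀ h₀) = 0 ∨ (2 : ℕ) • galPtOver M t (.some x₀ y₀ h₀) = tauOne))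
    (hS3 : ∀ g : M ≃ₐ[ℚ] M, D.TrivialOnLOver ι n g →
      ∃ π : Φ → Φ, Function.Bijective π ∧
        ∀ t : Φ, galPtOver M g (galPtOver M (t : M ≃ₐ[ℚ] M) (.some x₀ y₀ h₀)) = galPtOver M (π t : M ≃ₐ[ℚ] M) (.some x₀ y₀ h₀))
    {N₁ N₀ : D.H} (hN₁ : ι N₁ = ∏ t ∈ Φ, (t : M ≃ₐ[ℚ] M) x₀) (hN₀ : ι N₀ = ∏ t ∈ Φ, ((t : M ≃ₐ[ℚ] M) x₀ - 2 * ι D.im))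
    (hA1 : sqClass N₁ = 1) :
    ¬ ((∃ s : D.H, N₀ = s ^ 2) ∨ ∃ s : D.H, N₀ * D.im = s ^ 2) := by
  obtain ⟨hsq, h8, -⟩ := GenusPeriodNonTorsion.squarefree_and_mod_two_primes hl hq hl8 (Or.inr hq8) hn
  haveI := isElliptic_congruentNumberCurve hsq.ne_zero
  haveI := Literature.NumberTheory.EllipticCurves.isGloballyMinimal_congruentNumberCurve hsq
  obtain ⟨X, Y, h, hgen, hX⟩ := hvis
  have hZ : ¬ IsOfFinAddOrder (D.Z n) :=
    GenusPeriodNonTorsion.genusPeriod_not_isOfFinAddOrder_two_primes hGZK h12 hl hq hl8 (Or.inr hq8) hn hr D hPr hBl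
  have hZ2 : (2 : ℕ) • D.Z n ≠ 0 := fun h2 => hZ (isOfFinAddOrder_iff_nsmul_eq_zero.mpr ⟨2, two_pos, h2⟩)
  obtain ⟨N₁', hN₁', hne₁, hκ₁⟩ := GenusPeriodTraceNorm.twoDescentComponent_genusPeriod_eq_sqClass_norm_zero D ι h₀ Φ hS1.1 hS2 hS3 hZ2
  obtain ⟨N₀', hN₀', hne₀, hκ₀⟩ := GenusPeriodTraceNorm.twoDescentComponent_genusPeriod_eq_sqClass_norm D ι h₀ Φ hS1.1 hS2 hS3 hZ2
  have e₁ : N₁' = N₁ := ι.toRingHom.injective (by rw [AlgHom.toRingHom_eq_coe, AlgHom.coe_toRingHom, hN₁', hN₁])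
  have e₀ : N₀' = N₀ := ι.toRingHom.injective (by rw [AlgHom.toRingHom_eq_coe, AlgHom.coe_toRingHom, hN₀', hN₀])
  subst e₁; subst e₀
  exact (GenusPeriodSecondNorm.levelTwo_iff_secondNorm_of_visible_R2 hGZK hmod hCM0 h12 hl hq hl8 hq8 hn hr D hPr hCo hBl h hX hgen hne₀
    hκ₁ hκ₀ hA1).mp (hC n hsq h8 hr hSel2 hSel4)

end Summit.BirchSwinnertonDyer.PrintCf2.SecondNormLaws

end
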